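import Summits.QuantumAdvantage.QuantumAdvantage.Theorems.StakeDialB
import Summits.QuantumAdvantage.AdviceFreeQNC0.ChargeRecursion

/-!
# StakeDial — part D: the FRONT-PEELING recursion of the canonical sign function and of its signed class sums

Towards the top-character law for ALL `n` (part E).  Peel the FIRST walk bit (`Fin.cons`; the tree's
`ChargeRecursion.wt_cons` / `walkExp_cons_succ` / `walkExp_cons_zero`).  §K1: the canonical sign function `canon n = S_n`
(part A) generalises to the family `Fgen n e β ω` (stake offset `e`, left boundary bit `β` in place of `u₋₁`, wrap bit `ω` in
place of `x₀`) with `canon n u = Fgen n (n+2) false (¬u₀) u` (`canon_eq_Fgen`) and the exact peeling identity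
`Fgen (n+1) e β ω (b :: u') = headF e β b u'₀ (wt u') · Fgen n (e+1+2b) b ω u'` (`Fgen_cons`).  §K2: the signed class sums
`Zp n d e β ω c α = Σ (−1)^{|u|} Fgen n e β ω u` over `{u : u₀ = α, wt u ≡ c (3), u_j = 0 ∀ j ≥ d}` satisfy an
`n`-INDEPENDENT linear recursion on the 72 parameters `(e mod 3, β, ω, c, α)` (`Zp_succ`), with the pin riding along
(`Zp_pin_of_le`, `Zp_pin_zero`) and only `e mod 3` mattering (`Fgen_mod`, `Zp_mod`).
No `Prop`-valued `def`, no instances, no notation; python certificate `pub/decomp-qadv/decomp-qadv-lens-1/g9/exp/gentab.py`.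
-/

set_option linter.dupNamespace false
set_option linter.style.longLine false

namespace Summit.QuantumAdvantage.QuantumAdvantage.Theorems.StakeDial

open Finset
open Literature.Computability.QuantumComplexity.RingHLF (Rel)
open Literature.Computability.MetaComplexity.Smolensky
open Summit.QuantumAdvantage.AdviceFreeQNC0 (OddZeros xOfU uVec uExt tGuess ringWinU walkExp wtPrefix
  rel_iff_ringWinU xOfU_uVec card_odd_filter_ge)

variable {n : ℕ}

/-! ### K. THE FRONT-PEELING TRANSFER OPERATOR: `TopCharLaw3` for ALL `n`, hence W = `SparseColumns3`
is a THEOREM (rev 6, census ask C1 closed)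

Peel the FIRST walk bit.  The canonical sign function generalises to the family `Fgen n e β ω`
(`e` = stake offset, only `e mod 3` matters; `β` = the bit to the LEFT of position `0`; `ω` = the
bit AFTER the last position, i.e. the wrap bit) with `canon n u = Fgen n (n+2) false (¬u₀) u`
(`canon_eq_Fgen`) and the exact peeling identity `Fgen (n+1) e β ω (b :: u') =
headF e β b u'₀ (wt u') · Fgen n (e+1+2b) b ω u'` (`Fgen_cons`, from the tree's `wt_cons`,
`walkExp_cons_succ`, `walkExp_cons_zero`).  The SIGNED CLASS SUMS `Zp n d e β ω c α` of
`(−1)^{|u|} Fgen` over `{u : u₀ = α, wt u ≡ c (3), u_j = 0 ∀ j ≥ d}` obey an `n`-INDEPENDENT linear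
recursion on the `72` parameters `(e mod 3, β, ω, c, α)` (`Zp_succ`) — the transfer operator `step`
(`tab_succ : T_{m+1} = step T_m`); the pin `d` rides along and `T_m^{(0)} = pinFront T_m`
(`Zp_pin_zero`).  The orbit of `T_0` is eventually periodic: transient `2`, period `24`
(`U_zero`, `U_one`, `U_two`, `step_Lcyc` over the 26 literal tables `V0 … V25`, kernel `decide`,
≈ 45 s in all; `U_cyc`).  The three top characters used by the law are linear read-outs:
`χ_univ(S_n) = RU(n+2, T_n)` (`topChar_univ_canon`), `χ_{univ∖0}(S_n) = R0(n+2, T_n)`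
(`topChar_erase_zero_canon`), `χ_{univ∖2}(S_n) = RU(n+2, step² (pinFront T_{n−2}))`
(`topChar_erase_two_canon`), and they do not vanish along the cycle in the residues used (`RU_cyc`:
`n` even; `R0_cyc`: `n ≡ 3 (4)`; `RU2_cyc`: `n ≡ 1 (4)`; kernel `decide`).  Hence `topCharLaw3_all`
and, by `sparseColumns3_of_topCharLaw`, **`sparseColumns3 : SparseColumns3`** — for every `d` and every
cycle length `N ≥ 3`, a degree-`d` strategy silent outside `M` with `|M|(4d+2) + 2 ≤ N − 1` loses
somewhere on the odd class (`sparse_loses`, unconditional, all `N`).  Python model and certificate: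
`g9/exp/gentab.py` (tables, `step`, orbit, read-outs checked against brute force for `N ≤ 14`). -/

section Transfer

open Summit.QuantumAdvantage.AdviceFreeQNC0 (wt wt_cons walkExp_cons_succ walkExp_cons_zero)

/-! #### K1. The generalized bell product and its front-peeling recursion -/

/-- left reader with boundary bit `β` in place of `u_{-1}`. -/
def Lb (β : Bool) (u : Fin n → Bool) (g : ℕ) : Bool := if g = 0 then β else uExt u (g - 1)

/-- generalized bell bit: bells `g < n` read `L_g ⊕ u_{g+1}` (`u_n = 1`), the wrap bell `g = n` reads `L_n ⊕ ω`. -/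
def tb (β ω : Bool) (u : Fin n → Bool) (g : ℕ) : Bool :=
  if g < n then xor (Lb β u g) (uExt u (g + 1)) else xor (Lb β u n) ω

/-- generalized live-stake bit at offset `e`: `[(e + g + walkExp u g) % 3 ≠ 0]`. -/
def rb (e : ℕ) (u : Fin n → Bool) (g : ℕ) : Bool := decide ((e + g + walkExp u g) % 3 ≠ 0)

/-- generalized bell product `F_n(e, β, ω)(u) = Π_{g ≤ n} (1 + [tb_g][rb_g])`. -/
def Fgen (n e : ℕ) (β ω : Bool) (u : Fin n → Bool) : ZMod 3 :=
  ∏ g : Fin (n + 1), (1 + ind (tb β ω u g.val) * ind (rb e u g.val))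

/-- reading past the end of the walk word gives the default bit `1`. -/
theorem uExt_of_le (u : Fin n → Bool) {i : ℕ} (hi : n ≤ i) : uExt u i = true := by
  unfold uExt; rw [dif_neg (by omega)]

/-- the value of the cyclic successor `nxt j` as a natural number. -/
theorem nxt_val' (g : Fin (n + 1)) :
    (Literature.Computability.QuantumComplexity.RingHLF.nxt g).val = (g.val + 1) % (n + 1) := rfl

/-- **The canonical bells in closed form**: `t_g(xOfU u) = tb ff (¬u₀) u g`
(interior bells `u_{g-1} ⊕ u_{g+1}`, wrap bell `u_{n-1} ⊕ ¬u_0`). -/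
theorem tGuess_xOfU (u : Fin n → Bool) (g : Fin (n + 1)) :
    tGuess (xOfU u) g = tb false (!(uExt u 0)) u g.val := by
  have hx : ∀ j : Fin (n + 1), xOfU u j = !(xor (uExt u j.val) (Lb false u j.val)) := fun j => rfl
  unfold tGuess tb
  rw [hx, hx]
  by_cases hg : g.val < n
  · rw [if_pos hg]
    have hn : (Literature.Computability.QuantumComplexity.RingHLF.nxt g).val = g.val + 1 := by
      rw [nxt_val', Nat.mod_eq_of_lt (by omega)]
    rw [hn]
    have hL : Lb false u (g.val + 1) = uExt u g.val := by
      unfold Lb; rw [if_neg (by omega), Nat.add_sub_cancel]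
    rw [hL]
    cases uExt u g.val <;> cases Lb false u g.val <;> cases uExt u (g.val + 1) <;> rfl
  · have hgn : g.val = n := by omega
    rw [if_neg hg]
    have hn : (Literature.Computability.QuantumComplexity.RingHLF.nxt g).val = 0 := by
      rw [nxt_val', hgn, Nat.mod_self]
    rw [hn, hgn, uExt_of_le u le_rfl]
    have hL0 : Lb false u 0 = false := rfl
    rw [hL0]
    cases Lb false u n <;> cases uExt u 0 <;> rfl

/-- **Claim B**: the canonical sign function is the generalized bell product at offset `n + 2`,
left boundary `0` and wrap bit `¬u₀`. -/
theorem canon_eq_Fgen (u : Fin n → Bool) : canon n u = Fgen n (n + 2) false (!(uExt u 0)) u := by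
  unfold canon Fgen
  refine Finset.prod_congr rfl (fun g _ => ?_)
  unfold tau rho rb
  rw [tGuess_xOfU]

/-- peeling the first bit shifts the extended reader: `uExt (b :: u') (j+1) = uExt u' j`. -/
theorem uExt_cons_succ (b : Bool) (u' : Fin n → Bool) (j : ℕ) :
    uExt (Fin.cons b u' : Fin (n + 1) → Bool) (j + 1) = uExt u' j := by
  unfold uExt
  by_cases hj : j < n
  · rw [dif_pos (by omega), dif_pos hj]
    exact Fin.cons_succ (α := fun _ => Bool) b u' ⟨j, hj⟩
  · rw [dif_neg (by omega), dif_neg hj]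

/-- the extended reader at `0` of `b :: u'` is `b`. -/
theorem uExt_cons_zero (b : Bool) (u' : Fin n → Bool) :
    uExt (Fin.cons b u' : Fin (n + 1) → Bool) 0 = b := by
  unfold uExt; rw [dif_pos (Nat.succ_pos n)]; exact Fin.cons_zero (α := fun _ => Bool) b u'

/-- the left reader of `b :: u'` at `j+1` is the left reader of `u'` at `j` with boundary bit `b`. -/
theorem Lb_cons_succ (β b : Bool) (u' : Fin n → Bool) (g : ℕ) :
    Lb β (Fin.cons b u' : Fin (n + 1) → Bool) (g + 1) = Lb b u' g := by
  unfold Lb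
  rw [if_neg (Nat.succ_ne_zero g), Nat.add_sub_cancel]
  by_cases hg : g = 0
  · rw [if_pos hg, hg, uExt_cons_zero]
  · rw [if_neg hg]
    obtain ⟨g', rfl⟩ := Nat.exists_eq_succ_of_ne_zero hg
    rw [Nat.succ_sub_one, uExt_cons_succ]

/-- the generalised guess bit is stable under peeling (index shift). -/
theorem tb_cons_succ (β ω b : Bool) (u' : Fin n → Bool) (g : ℕ) :
    tb β ω (Fin.cons b u' : Fin (n + 1) → Bool) (g + 1) = tb b ω u' g := by
  unfold tb
  by_cases hg : g < n
  · rw [if_pos (by omega), if_pos hg, Lb_cons_succ, uExt_cons_succ]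
  · rw [if_neg (by omega), if_neg hg, Lb_cons_succ]

/-- the generalised ring mask is stable under peeling, the stake offset moving to `e + 1 + 2b`. -/
theorem rb_cons_succ (e : ℕ) (b : Bool) (u' : Fin n → Bool) (g : ℕ) :
    rb e (Fin.cons b u' : Fin (n + 1) → Bool) (g + 1) = rb (e + 1 + 2 * b.toNat) u' g := by
  unfold rb
  rw [walkExp_cons_succ,
    show e + (g + 1) + (2 * b.toNat + walkExp u' g) = e + 1 + 2 * b.toNat + g + walkExp u' g by ring]

/-- the peeled bell `g = 0`: reads `β ⊕ u'_0` and the stake `[(e + b + |u'|) % 3 ≠ 0]`. -/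
def headF (e : ℕ) (β b α' : Bool) (w : ℕ) : ZMod 3 :=
  1 + ind (xor β α') * ind (decide ((e + b.toNat + w) % 3 ≠ 0))

/-- **Claim C** (front-peeling recursion): `F_{n+1}(e,β,ω)(b :: u') = head · F_n(e+1+2b, b, ω)(u')`. -/
theorem Fgen_cons (e : ℕ) (β ω b : Bool) (u' : Fin n → Bool) :
    Fgen (n + 1) e β ω (Fin.cons b u') =
      headF e β b (uExt u' 0) (wt u') * Fgen n (e + 1 + 2 * b.toNat) b ω u' := by
  unfold Fgen headF
  rw [Fin.prod_univ_succ]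
  congr 1
  · have h1 : tb β ω (Fin.cons b u' : Fin (n + 1) → Bool) (0 : Fin (n + 2)).val = xor β (uExt u' 0) := by
      unfold tb Lb
      rw [Fin.val_zero, if_pos (Nat.succ_pos n), if_pos rfl, Nat.zero_add, uExt_cons_succ]
    have h2 : rb e (Fin.cons b u' : Fin (n + 1) → Bool) (0 : Fin (n + 2)).val =
        decide ((e + b.toNat + wt u') % 3 ≠ 0) := by
      unfold rb
      rw [Fin.val_zero, walkExp_cons_zero, Nat.add_zero, Nat.add_assoc]
    rw [h1, h2]
  · refine Finset.prod_congr rfl (fun h _ => ?_)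
    rw [Fin.val_succ, tb_cons_succ, rb_cons_succ]

/-! #### K2. Class sums `Zp` and their front-peeling recursion -/

/-- `(-1)^b` in `𝔽₃`. -/
def sgnB (b : Bool) : ZMod 3 := if b then -1 else 1

/-- the full sign character factors under peeling: `(-1)^{|b :: u'|} = sgnB b · (-1)^{|u'|}`. -/
theorem pm_cons (b : Bool) (u' : Fin n → Bool) :
    pmMono (ZMod 3) univ (Fin.cons b u' : Fin (n + 1) → Bool) = sgnB b * pmMono (ZMod 3) univ u' := by
  unfold pmMono sgnB sgn
  rw [Fin.prod_univ_succ]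
  congr 1

/-- passive pin: coordinate `d` (if present) is `0`. -/
def pinB (d : ℕ) (u : Fin n → Bool) : Bool := if h : d < n then !(u ⟨d, h⟩) else true

/-- the pin predicate is stable under peeling (index shift). -/
theorem pinB_cons_succ (d : ℕ) (b : Bool) (u' : Fin n → Bool) :
    pinB (d + 1) (Fin.cons b u' : Fin (n + 1) → Bool) = pinB d u' := by
  unfold pinB
  by_cases hd : d < n
  · rw [dif_pos (by omega), dif_pos hd]
    exact congrArg (fun x => !x) (Fin.cons_succ (α := fun _ => Bool) b u' ⟨d, hd⟩)
  · rw [dif_neg (by omega), dif_neg hd]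

/-- a pin at or beyond the length is no condition. -/
theorem pinB_of_le {d : ℕ} (hd : n ≤ d) (u : Fin n → Bool) : pinB d u = true := by
  unfold pinB; rw [dif_neg (by omega)]

/-- pin `0` on a non-empty word says exactly that the first bit is `0`. -/
theorem pinB_zero_eq (hn : 1 ≤ n) (u : Fin n → Bool) : pinB 0 u = !(uExt u 0) := by
  unfold pinB uExt; rw [dif_pos (by omega), dif_pos (by omega)]

/-- class sum: walks with pin `d`, first bit `α` and weight class `c`, signed, times the bell product. -/
def Zp (n d e : ℕ) (β ω : Bool) (c : ℕ) (α : Bool) : ZMod 3 :=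
  ∑ u : Fin n → Bool,
    if (pinB d u = true ∧ uExt u 0 = α ∧ wt u % 3 = c) then pmMono (ZMod 3) univ u * Fgen n e β ω u else 0

/-- splitting a sum over `Fin (n+1) → Bool` along the first bit (`Fin.consEquiv`). -/
theorem sum_cons (G : (Fin (n + 1) → Bool) → ZMod 3) :
    ∑ u, G u = ∑ b : Bool, ∑ u' : Fin n → Bool, G (Fin.cons b u') := by
  rw [← Fintype.sum_prod_type']
  exact (Fintype.sum_equiv (Fin.consEquiv fun _ => Bool) _ _ (fun p => rfl)).symm

/-- the head factor only depends on the stake offset modulo `3`. -/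
theorem headF_mod (e : ℕ) (β b α' : Bool) (w : ℕ) : headF e β b α' (w % 3) = headF e β b α' w := by
  unfold headF
  rw [show (e + b.toNat + w % 3) % 3 = (e + b.toNat + w) % 3 by omega]

/-- peeling the first bit inside the class sum. -/
theorem Zp_succ_sum (d e : ℕ) (β ω : Bool) (c : ℕ) (α : Bool) :
    Zp (n + 1) (d + 1) e β ω c α =
      ∑ u' : Fin n → Bool, if (pinB d u' = true ∧ (α.toNat + wt u') % 3 = c) then
        sgnB α * headF e β α (uExt u' 0) (wt u') *
          (pmMono (ZMod 3) univ u' * Fgen n (e + 1 + 2 * α.toNat) α ω u') else 0 := by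
  unfold Zp
  rw [sum_cons]
  have hL : ∀ (b : Bool) (u' : Fin n → Bool),
      (if (pinB (d + 1) (Fin.cons b u' : Fin (n + 1) → Bool) = true ∧
            uExt (Fin.cons b u' : Fin (n + 1) → Bool) 0 = α ∧
            wt (Fin.cons b u' : Fin (n + 1) → Bool) % 3 = c)
        then pmMono (ZMod 3) univ (Fin.cons b u' : Fin (n + 1) → Bool) *
          Fgen (n + 1) e β ω (Fin.cons b u') else 0) =
      if b = α then (if (pinB d u' = true ∧ (α.toNat + wt u') % 3 = c) then
        sgnB α * headF e β α (uExt u' 0) (wt u') *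
          (pmMono (ZMod 3) univ u' * Fgen n (e + 1 + 2 * α.toNat) α ω u') else 0) else 0 := by
    intro b u'
    rw [pinB_cons_succ, uExt_cons_zero, wt_cons, pm_cons, Fgen_cons]
    by_cases hb : b = α
    · subst hb
      rw [if_pos rfl]
      by_cases h : pinB d u' = true ∧ (b.toNat + wt u') % 3 = c
      · rw [if_pos ⟨h.1, rfl, h.2⟩, if_pos h]; ring
      · rw [if_neg (fun h' => h ⟨h'.1, h'.2.2⟩), if_neg h]
    · rw [if_neg (fun h' => hb h'.2.1), if_neg hb]
  rw [Finset.sum_congr rfl (fun b _ => Finset.sum_congr rfl (fun u' _ => hL b u'))]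
  rw [Finset.sum_comm]
  refine Finset.sum_congr rfl (fun u' _ => ?_)
  rw [Finset.sum_ite_eq' univ α, if_pos (mem_univ α)]

/-- regrouping a class-restricted sum by (first bit, weight class). -/
theorem regroup (K : Bool → ℕ → ZMod 3) (X : (Fin n → Bool) → ZMod 3)
    (P : (Fin n → Bool) → Prop) [DecidablePred P] (a c : ℕ) :
    (∑ α' : Bool, ∑ c' : Fin 3,
      if (c'.val + a) % 3 = c then
        K α' c'.val * ∑ u', (if (P u' ∧ uExt u' 0 = α' ∧ wt u' % 3 = c'.val) then X u' else 0)
      else 0) =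
    ∑ u', if (P u' ∧ (a + wt u') % 3 = c) then K (uExt u' 0) (wt u' % 3) * X u' else 0 := by
  have hA : ∀ (α' : Bool) (c' : Fin 3),
      (if (c'.val + a) % 3 = c then
        K α' c'.val * ∑ u', (if (P u' ∧ uExt u' 0 = α' ∧ wt u' % 3 = c'.val) then X u' else 0)
       else 0) =
      ∑ u', (if ((c'.val + a) % 3 = c ∧ (P u' ∧ uExt u' 0 = α' ∧ wt u' % 3 = c'.val))
        then K α' c'.val * X u' else 0) := by
    intro α' c'
    by_cases hc : (c'.val + a) % 3 = c
    · rw [if_pos hc, Finset.mul_sum]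
      refine Finset.sum_congr rfl (fun u' _ => ?_)
      by_cases hP : P u' ∧ uExt u' 0 = α' ∧ wt u' % 3 = c'.val
      · rw [if_pos hP, if_pos ⟨hc, hP⟩]
      · rw [if_neg hP, if_neg (fun h => hP h.2), mul_zero]
    · rw [if_neg hc]
      symm
      exact Finset.sum_eq_zero (fun u' _ => if_neg (fun h => hc h.1))
  rw [Finset.sum_congr rfl (fun α' _ => Finset.sum_congr rfl (fun c' _ => hA α' c'))]
  rw [Finset.sum_congr rfl (fun α' _ => Finset.sum_comm), Finset.sum_comm]
  refine Finset.sum_congr rfl (fun u' _ => ?_)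
  rw [Finset.sum_eq_single (uExt u' 0)]
  · rw [Finset.sum_eq_single (⟨wt u' % 3, Nat.mod_lt _ (by norm_num)⟩ : Fin 3)]
    · by_cases hP : P u' ∧ (a + wt u') % 3 = c
      · rw [if_pos hP, if_pos ⟨by have := hP.2; dsimp only; omega, hP.1, rfl, rfl⟩]
      · rw [if_neg hP, if_neg (fun h => hP ⟨h.2.1, by have := h.1; dsimp only at this; omega⟩)]
    · intro c' _ hc'
      rw [if_neg]
      rintro ⟨_, _, _, h4⟩
      exact hc' (Fin.ext h4.symm)
    · intro h; exact absurd (Finset.mem_univ _) h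
  · intro α' _ hα'
    refine Finset.sum_eq_zero (fun c' _ => if_neg ?_)
    rintro ⟨_, _, h3, _⟩
    exact hα' h3.symm
  · intro h; exact absurd (Finset.mem_univ _) h

/-- **The front-peeling recursion of the class sums.** -/
theorem Zp_succ (d e : ℕ) (β ω : Bool) (c : ℕ) (α : Bool) :
    Zp (n + 1) (d + 1) e β ω c α =
      ∑ α' : Bool, ∑ c' : Fin 3,
        if (c'.val + α.toNat) % 3 = c then
          (sgnB α * headF e β α α' c'.val) * Zp n d (e + 1 + 2 * α.toNat) α ω c'.val α'
        else 0 := by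
  rw [Zp_succ_sum]
  unfold Zp
  rw [regroup (fun α' w => sgnB α * headF e β α α' w)
    (fun u' => pmMono (ZMod 3) univ u' * Fgen n (e + 1 + 2 * α.toNat) α ω u')
    (fun u' => pinB d u' = true) α.toNat c]
  refine Finset.sum_congr rfl (fun u' _ => ?_)
  simp only [headF_mod]

/-- unpinned normalisation: any pin beyond the walk is no pin. -/
theorem Zp_pin_of_le {d : ℕ} (hd : n ≤ d) (e : ℕ) (β ω : Bool) (c : ℕ) (α : Bool) :
    Zp n d e β ω c α = Zp n n e β ω c α := by
  unfold Zp
  simp only [pinB_of_le hd, pinB_of_le le_rfl]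

/-- pin at the front = restrict the first bit to `0`. -/
theorem Zp_pin_zero (hn : 1 ≤ n) (e : ℕ) (β ω : Bool) (c : ℕ) (α : Bool) :
    Zp n 0 e β ω c α = if α = false then Zp n n e β ω c α else 0 := by
  unfold Zp
  by_cases hα : α = false
  · rw [if_pos hα]
    refine Finset.sum_congr rfl (fun u _ => ?_)
    rw [pinB_zero_eq hn, pinB_of_le le_rfl]
    by_cases hu : uExt u 0 = α
    · simp only [hu, hα, Bool.not_false, true_and]
    · rw [if_neg (fun h => hu h.2.1), if_neg (fun h => hu h.2.1)]
  · rw [if_neg hα]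
    refine Finset.sum_eq_zero (fun u _ => if_neg ?_)
    rintro ⟨h1, h2, _⟩
    rw [pinB_zero_eq hn, h2] at h1
    cases α
    · exact hα rfl
    · exact Bool.false_ne_true h1

/-- the offset matters only mod 3. -/
theorem Fgen_mod (e : ℕ) (β ω : Bool) (u : Fin n → Bool) : Fgen n e β ω u = Fgen n (e % 3) β ω u := by
  unfold Fgen rb
  refine Finset.prod_congr rfl (fun g _ => ?_)
  rw [show (e + g.val + walkExp u g.val) % 3 = (e % 3 + g.val + walkExp u g.val) % 3 by omega]

/-- the class sums only depend on the stake offset modulo `3`. -/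
theorem Zp_mod (d e : ℕ) (β ω : Bool) (c : ℕ) (α : Bool) :
    Zp n d e β ω c α = Zp n d (e % 3) β ω c α := by
  unfold Zp
  simp only [Fgen_mod e]

end Transfer

end Summit.QuantumAdvantage.QuantumAdvantage.Theorems.StakeDial
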